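import Literature.AlgebraicGeometry.HodgeTheory.SmoothProjectiveComponents
import Literature.AlgebraicGeometry.HodgeTheory.MotivatedClassesDeformationInputs
import Literature.AlgebraicGeometry.Resolution.SmoothStalksRegular
import Literature.AlgebraicGeometry.Motives.UniversalHypersurfaceQuasiProjective
import Literature.NumberTheory.Transcendental.AnalytificationConnectedProofs
import HarnessLib

/-!
# A smooth quasi-projective complex scheme is the COPRODUCT of its (finitely many) components, and their
# complex points are the connected components of `X(ℂ)`

Family `hodge`, layer `Literature/AlgebraicGeometry/HodgeTheory`.  PROOF FILE (theorems only; no definition, no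
named fact).  Quasi-projective, not-necessarily-equidimensional sibling of the tree's
`HodgeTheory.exists_components_isSmoothProjective_isColimit` (`SmoothProjectiveComponents.lean`), with the
analytic reading added: for `X` smooth and quasi-projective over `ℂ`, the irreducible components `E_c ↪ X` are
open AND closed subschemes (the local rings of a smooth scheme are domains, Görtz–Wedhorn I Ex. 3.16), FINITE in
number (`X` is Noetherian), each irreducible, quasi-projective and smooth of SOME relative dimension `d_c`
(Görtz–Wedhorn I Thm. 6.28: the relative dimension is locally constant), the cofan `(E_c ⟶ X)_c` is a colimit in
`SchemeOver ℂ` (Mathlib `AlgebraicGeometry.nonempty_isColimit_cofanMk_of`, lifted along `Over.forget`), and on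
complex points the images `E_c(ℂ) ⊆ X(ℂ)` form a clopen partition BY CONNECTED SETS — so they are exactly the
connected components of `X(ℂ)` in the analytic topology (SGA1 XII Prop. 2.4 «`X` irréductible ⇒ `X^an` connexe»,
the tree's theorem `Motives.ComplexPoints.isConnected_setOf_pt_mem_of_isIrreducible_holds`).

* (private) `connectedComponent_eq_of_isClopenPartition` — topological lemma: a piece of a clopen partition that is
  preconnected is the connected component of each of its points;
* `exists_components_isColimit_of_smooth` — the statement above;
* `nonempty_equiv_connectedComponents_of_smooth` — corollary: the index set of the components is in bijection
  with `ConnectedComponents (X(ℂ))`, compatibly with the images.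

Use (cell hodgecm-mathlib, U-DAG node U-d / clause (U1) of ★ `siegelModuli_complexUniformisation`): for
`X = 𝓜 ⊗_ℚ ℂ`, `𝓜` the Siegel fine moduli scheme of (F) ★ `lan2013_siegelFineModuliScheme` (smooth and
quasi-projective over `ℚ`, hence over `ℂ`), this is the component cofan of (U1) with `IrreducibleSpace (S_c)`,
leaving only the identification of the index set with `(ℤ/N)ˣ` (the Weil-pairing class) to the uniformisation.

## References
* [GortzWedhorn2020] U. Görtz, T. Wedhorn, *Algebraic Geometry I* (2nd ed. 2020), Exercise 3.16 (p. 117) (local rings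
  of a smooth scheme are domains; components open and disjoint), Thm. 6.28 (relative dimension locally constant).
* [SGA1] A. Grothendieck, M. Raynaud, SGA 1, Exp. XII Prop. 2.4 (`X` connexe ⇔ `X^an` connexe).
* [StacksProject] Tag 0BA8 (a Noetherian topological space has finitely many irreducible components).
-/

set_option autoImplicit false

noncomputable section

open CategoryTheory CategoryTheory.Limits AlgebraicGeometry Set Function
open Literature.AlgebraicTopology.SingularHomology

namespace Literature.AlgebraicGeometry.HodgeTheory

open _root_.Topology
open Literature.AlgebraicGeometry.Motives

universe u v

/-- **A preconnected piece of a clopen partition is a connected component.** If the sets `A j` form a clopen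
partition of `Z` and `A k` is preconnected, then `A k` is the connected component of each of its points.
[folklore] -/
private theorem connectedComponent_eq_of_isClopenPartition {Z : Type u} [TopologicalSpace Z] {ι : Type v}
    {A : ι → Set Z} (h : IsClopenPartition A) {k : ι} (hk : IsPreconnected (A k)) {z : Z} (hz : z ∈ A k) :
    connectedComponent z = A k := by
  refine Subset.antisymm ?_ (hk.subset_connectedComponent hz)
  -- `A k` is clopen: its complement is the union of the other (open) pieces
  have hclosed : IsClosed (A k) := by
    have hcompl : (A k)ᶜ = ⋃ j ∈ {j | j ≠ k}, A j := by
      ext x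
      simp only [mem_compl_iff, mem_iUnion, mem_setOf_eq, exists_prop]
      constructor
      · intro hx
        obtain ⟨j, hj⟩ := h.exists_mem x
        exact ⟨j, fun hjk => hx (hjk ▸ hj), hj⟩
      · rintro ⟨j, hjk, hj⟩ hxk
        exact hjk (h.eq_of_mem hj hxk)
    rw [← isOpen_compl_iff, hcompl]
    exact isOpen_biUnion fun j _ => h.isOpen j
  exact (IsClopen.connectedComponent_subset ⟨hclosed, h.isOpen k⟩ hz)

variable (X : SchemeOver ℂ)

/-- **A smooth quasi-projective complex scheme is the finite coproduct of its components; their complex points are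
the connected components of `X(ℂ)`.**  For `X` smooth and quasi-projective over `ℂ` there are finitely many
`ℂ`-schemes `E_c` with morphisms `e_c : E_c ⟶ X` over `ℂ` that are open and closed immersions, each `E_c`
irreducible, quasi-projective and smooth of some relative dimension `d_c` over `ℂ`, with `E_c(ℂ)` connected, whose
images on complex points form a clopen partition of `X(ℂ)` each piece of which is the connected component of its
points, and the cofan `(e_c)_c` is a COLIMIT in `SchemeOver ℂ` (`X ≅ ∐_c E_c`).  Construction: the `E_c` are the
open subschemes on the irreducible components (open because the local rings of the smooth `X` are domains,
Görtz–Wedhorn I Ex. 3.16; pairwise disjoint; covering; finitely many since `X` is Noetherian); `E_c(ℂ)` is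
connected by SGA1 XII Prop. 2.4 (the tree's `Motives.ComplexPoints.isConnected_setOf_pt_mem_of_isIrreducible_holds`);
the relative dimension of the smooth connected `E_c` is constant (Görtz–Wedhorn I Thm. 6.28, the tree's
`exists_smoothOfRelativeDimension_of_connectedSpace_complexPoints`).
[cite: GortzWedhorn2020, Exercise 3.16 (p. 117) and Thm. 6.28] [cite: SGA1, Exp. XII Prop. 2.4]
[cite: StacksProject, Tag 0BA8] -/
theorem exists_components_isColimit_of_smooth [Smooth X.hom] (hX : IsQuasiProjectiveOver X) :
    ∃ (C : Type) (_ : Finite C) (E : C → SchemeOver ℂ) (e : ∀ c, E c ⟶ X),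
      (∀ c, IsOpenImmersion (e c).left) ∧ (∀ c, IsClosedImmersion (e c).left) ∧
        (∀ c, IrreducibleSpace (E c).left) ∧ (∀ c, IsQuasiProjectiveOver (E c)) ∧
        (∀ c, ∃ d : ℕ, SmoothOfRelativeDimension d (E c).hom) ∧
        (∀ c, ConnectedSpace (ComplexPoints (E c))) ∧
        IsClopenPartition (fun c => Set.range (AlgPoints.map (L := ℂ) (e c))) ∧
        (∀ c, ∀ P ∈ Set.range (AlgPoints.map (L := ℂ) (e c)),
          connectedComponent P = Set.range (AlgPoints.map (L := ℂ) (e c))) ∧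
        Nonempty (IsColimit (Cofan.mk X e)) := by
  classical
  haveI : LocallyOfFiniteType X.hom := hX.locallyOfFiniteType
  haveI : QuasiCompact X.hom := hX.isVarietyPair_ofScheme.quasiCompact
  haveI : IsLocallyNoetherian X.left := LocallyOfFiniteType.isLocallyNoetherian X.hom
  haveI : CompactSpace X.left := (quasiCompact_iff_compactSpace X.hom).mp inferInstance
  haveI : IsNoetherian X.left := { }
  have hdom : ∀ x : X.left, IsDomain (X.left.presheaf.stalk x) := fun x ↦
    Resolution.isDomain_stalk_of_smooth X.hom x
  -- the components, as open subschemes; finitely many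
  set C := irreducibleComponents X.left with hC
  haveI hfin : Finite C := (TopologicalSpace.NoetherianSpace.finite_irreducibleComponents (α := X.left)).to_subtype
  have hopen : ∀ Z : C, IsOpen (Z.1 : Set X.left) := fun Z ↦
    isOpen_of_mem_irreducibleComponents_of_isDomain_stalk hdom Z.2
  let U : C → X.left.Opens := fun Z ↦ ⟨Z.1, hopen Z⟩
  let EZ : C → SchemeOver ℂ := fun Z ↦ Over.mk ((U Z).ι ≫ X.hom)
  let eZ : ∀ Z : C, EZ Z ⟶ X := fun Z ↦ Over.homMk (U Z).ι rfl
  haveI heZopen : ∀ Z : C, IsOpenImmersion (eZ Z).left := fun Z ↦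
    inferInstanceAs (IsOpenImmersion (U Z).ι)
  have hrangeZ : ∀ Z : C, Set.range (U Z).ι = (Z.1 : Set X.left) := fun Z ↦ Scheme.Opens.range_ι _
  have hopensRange : ∀ Z : C, (eZ Z).left.opensRange = U Z := fun Z ↦ Scheme.Opens.opensRange_ι _
  haveI heZclosed : ∀ Z : C, IsClosedImmersion (eZ Z).left := fun Z ↦ by
    refine IsClosedImmersion.of_isPreimmersion _ ?_
    change IsClosed (Set.range (U Z).ι)
    rw [hrangeZ]
    exact isClosed_of_mem_irreducibleComponents _ Z.2
  -- each component is irreducible, quasi-projective, smooth, with connected complex points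
  have hirr : ∀ Z : C, IrreducibleSpace (EZ Z).left := fun Z ↦ by
    change IrreducibleSpace (U Z)
    have hirr : IsIrreducible ((U Z : X.left.Opens) : Set X.left) := Z.2.1
    exact Subtype.irreducibleSpace hirr
  have hqp : ∀ Z : C, IsQuasiProjectiveOver (EZ Z) := fun Z ↦
    IsQuasiProjectiveOver.of_isOpenImmersion (eZ Z) hX
  have hsmooth : ∀ Z : C, Smooth (EZ Z).hom := fun Z ↦
    IsZariskiLocalAtSource.comp (P := @Smooth) ‹Smooth X.hom› (U Z).ι
  have hlft : ∀ Z : C, LocallyOfFiniteType (EZ Z).hom := fun Z ↦ (hqp Z).locallyOfFiniteType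
  have hconn : ∀ Z : C, ConnectedSpace (ComplexPoints (EZ Z)) := fun Z ↦ by
    haveI := hirr Z
    haveI := hlft Z
    haveI : ConnectedSpace (EZ Z).left := inferInstance
    exact (Motives.ComplexPoints.connectedSpace_iff_holds (EZ Z)).mpr this
  have hdim : ∀ Z : C, ∃ d : ℕ, SmoothOfRelativeDimension d (EZ Z).hom := fun Z ↦ by
    haveI := hsmooth Z
    haveI := hlft Z
    haveI := hconn Z
    exact exists_smoothOfRelativeDimension_of_connectedSpace_complexPoints (EZ Z)
  -- the complex points of the components form a clopen partition of `X(ℂ)`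
  let A : C → Set (ComplexPoints X) := fun Z ↦ Set.range (AlgPoints.map (L := ℂ) (eZ Z))
  have hArange : ∀ Z : C, A Z = {P : ComplexPoints X | P.pt ∈ (Z.1 : Set X.left)} := by
    intro Z
    change Set.range (AlgPoints.map (L := ℂ) (eZ Z)) = _
    rw [AlgPoints.range_map_of_isOpenImmersion_holds (L := ℂ) (eZ Z)]
    ext P
    change P.pt ∈ (((U Z).ι.opensRange : X.left.Opens) : Set X.left) ↔ P.pt ∈ (Z.1 : Set X.left)
    rw [Scheme.Opens.opensRange_ι]
    rfl
  have hdisjZ : ∀ Z₁ Z₂ : C, Z₁ ≠ Z₂ → Disjoint (Z₁.1 : Set X.left) Z₂.1 := fun Z₁ Z₂ hne ↦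
    disjoint_of_mem_irreducibleComponents_of_isOpen Z₁.2 Z₂.2 (hopen Z₂) (fun h ↦ hne (Subtype.ext h))
  have hA : IsClopenPartition A := by
    refine IsClopenPartition.of_pairwise_disjoint (fun Z ↦ ?_) (fun Z₁ Z₂ hne ↦ ?_) ?_
    · exact (AlgPoints.isOpenEmbedding_map_holds (L := ℂ) (eZ Z)).isOpen_range
    · change Disjoint (A Z₁) (A Z₂)
      rw [hArange, hArange, Set.disjoint_left]
      intro P h₁ h₂
      exact Set.disjoint_left.mp (hdisjZ Z₁ Z₂ hne) h₁ h₂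
    · refine Set.eq_univ_of_forall fun P ↦ Set.mem_iUnion.mpr ?_
      refine ⟨⟨irreducibleComponent P.pt, irreducibleComponent_mem_irreducibleComponents _⟩, ?_⟩
      rw [hArange]
      exact mem_irreducibleComponent
  -- each piece is connected, hence a connected component of `X(ℂ)`
  have hAconn : ∀ Z : C, IsPreconnected (A Z) := fun Z ↦ by
    haveI := hconn Z
    simpa only [A, ← Set.image_univ] using
      isPreconnected_univ.image _
        (AlgPoints.isOpenEmbedding_map_holds (L := ℂ) (eZ Z)).continuous.continuousOn
  have hcomp : ∀ Z : C, ∀ P ∈ A Z, connectedComponent P = A Z := fun Z P hP ↦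
    connectedComponent_eq_of_isClopenPartition hA (hAconn Z) hP
  -- the cofan of the components is a colimit of schemes …
  have hcov : ⨆ Z : C, (eZ Z).left.opensRange = ⊤ := by
    rw [eq_top_iff]
    rintro x -
    refine TopologicalSpace.Opens.mem_iSup.mpr
      ⟨⟨irreducibleComponent x, irreducibleComponent_mem_irreducibleComponents _⟩, ?_⟩
    rw [hopensRange]
    exact mem_irreducibleComponent
  have hdisj : Pairwise (Disjoint on fun Z : C => (eZ Z).left.opensRange) := by
    intro Z₁ Z₂ hne
    change Disjoint (eZ Z₁).left.opensRange (eZ Z₂).left.opensRange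
    rw [hopensRange, hopensRange, ← TopologicalSpace.Opens.coe_disjoint]
    exact hdisjZ Z₁ Z₂ hne
  obtain ⟨hS⟩ := nonempty_isColimit_cofanMk_of (fun Z : C => (eZ Z).left) hcov hdisj
  -- … hence in `SchemeOver ℂ` (`Over.forget` creates colimits)
  have hOver : Nonempty (IsColimit (Cofan.mk X eZ)) := by
    have h2 : IsColimit ((Over.forget (Spec (CommRingCat.of ℂ))).mapCocone (Cofan.mk X eZ)) :=
      (Cofan.isColimitMapCoconeEquiv (Over.forget (Spec (CommRingCat.of ℂ))) EZ (Cofan.mk X eZ)).symm hS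
    exact ⟨isColimitOfReflects (Over.forget _) h2⟩
  exact ⟨C, hfin, EZ, eZ, heZopen, heZclosed, hirr, hqp, hdim, hconn, hA, hcomp, hOver⟩

/-- **The components of a smooth quasi-projective complex scheme are indexed by `π₀(X(ℂ))`.**  With `E_c ⟶ X` the
component cofan of `exists_components_isColimit_of_smooth`, the index set is in bijection with the connected
components of `X(ℂ)` in the analytic topology, the bijection sending `c` to the component `E_c(ℂ)`.
[cite: SGA1, Exp. XII Prop. 2.4] [cite: GortzWedhorn2020, Exercise 3.16 (p. 117)] -/
theorem nonempty_equiv_connectedComponents_of_smooth [Smooth X.hom] (hX : IsQuasiProjectiveOver X) :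
    ∃ (C : Type) (_ : Finite C) (E : C → SchemeOver ℂ) (e : ∀ c, E c ⟶ X)
      (σ : C ≃ ConnectedComponents (ComplexPoints X)),
      (∀ c, IsOpenImmersion (e c).left) ∧ (∀ c, IrreducibleSpace (E c).left) ∧
        Nonempty (IsColimit (Cofan.mk X e)) ∧
        ∀ c, ConnectedComponents.mk ⁻¹' {σ c} = Set.range (AlgPoints.map (L := ℂ) (e c)) := by
  obtain ⟨C, hfin, E, e, hopen, -, hirr, -, -, hconn, hA, hcomp, hcol⟩ :=
    exists_components_isColimit_of_smooth X hX
  -- every piece `E_c(ℂ)` is nonempty (a connected space is nonempty)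
  have hne : ∀ c, (Set.range (AlgPoints.map (L := ℂ) (e c))).Nonempty := fun c ↦ by
    haveI := hconn c
    obtain ⟨P⟩ := (inferInstance : Nonempty (ComplexPoints (E c)))
    exact ⟨_, P, rfl⟩
  let pick : C → ComplexPoints X := fun c ↦ (hne c).some
  have hpick : ∀ c, pick c ∈ Set.range (AlgPoints.map (L := ℂ) (e c)) := fun c ↦ (hne c).some_mem
  -- the map `c ↦ [P_c]` for the chosen `P_c ∈ E_c(ℂ)`
  let τ : C → ConnectedComponents (ComplexPoints X) := fun c ↦ ConnectedComponents.mk (pick c)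
  have hτ : ∀ c, ConnectedComponents.mk ⁻¹' {τ c} = Set.range (AlgPoints.map (L := ℂ) (e c)) :=
    fun c ↦ by
    change ConnectedComponents.mk ⁻¹' {ConnectedComponents.mk (pick c)} = _
    rw [connectedComponents_preimage_singleton, hcomp c _ (hpick c)]
  have hinj : Function.Injective τ := fun c c' h ↦ by
    have h1 : pick c ∈ ConnectedComponents.mk ⁻¹' {τ c'} := by
      rw [← h]
      exact rfl
    rw [hτ c'] at h1
    exact hA.eq_of_mem (hpick c) h1
  have hsurj : Function.Surjective τ := fun q ↦ by
    obtain ⟨P, rfl⟩ := ConnectedComponents.surjective_coe q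
    obtain ⟨c, hc⟩ := hA.exists_mem P
    refine ⟨c, ?_⟩
    change ConnectedComponents.mk (pick c) = ConnectedComponents.mk P
    rw [ConnectedComponents.coe_eq_coe, hcomp c _ (hpick c), hcomp c _ hc]
  exact ⟨C, hfin, E, e, Equiv.ofBijective τ ⟨hinj, hsurj⟩, hopen, hirr, hcol, fun c ↦ hτ c⟩

end Literature.AlgebraicGeometry.HodgeTheory

end
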